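import Summits.Langlands.Langlands.Theses.ImaginaryQuadraticAnchor
import Literature.NumberTheory.Automorphic.GLnAdelicStructureProofs

/-!
# Birth skeleton (BC3) of the crux `RelativeDescent` (stmt-Langlands-18736)

Route `ImaginaryQuadraticAnchor` (crux rank 3): `K` imaginary quadratic, `L ⊃ K` finite,
`ρ : Γ_L → GL_n(ℚ̄_ℓ)` irreducible and geometric; IF every irreducible geometric
`σ : Γ_K → GL_m(ℚ̄_ℓ)` having `ρ` as a block summand of `σ|Γ_L` corresponds (full local–global
compatibility, data `RK`) to an L-algebraic cuspidal `Π` on `GL_m(𝔸_K)`, THEN `ρ` corresponds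
(data `RL`) to an L-algebraic cuspidal `π` on `GL_n(𝔸_L)`.

## The line: one induced constituent, descended weakly, then upgraded place by place

The hypothesis family is consumed at ONE representation: an irreducible constituent `σ` of
`Ind_{Γ_L}^{Γ_K} ρ` through which `ρ` factors.  The crux is cut at its three joints:

* `stub_inducedConstituent` — GALOIS SIDE (Clifford–Mackey–Fontaine; size M–L, provable from the
  tree modulo the named p-adic Hodge schemata): for ANY finite extension of number fields `L/K`
  and any irreducible geometric `ρ` over `L` there is an irreducible `σ` over `K`, geometric for
  the pinned Fontaine data, with `σ|Γ_L ≃ ρ ⊞ τ` in some frame (`conj g (σ|Γ_L) = reindex e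
  (ρ ⊞ τ)`).  Mechanism: `V = Ind ρ` is semisimple (characteristic `0`, finite index), Frobenius
  reciprocity picks an irreducible summand `σ` of `V` receiving `ρ` non-trivially, `σ|Γ_L` is
  semisimple (Clifford for the normal core `Γ_M`, `M` = Galois closure, then averaging over the
  finite quotient), so `ρ` splits off; `σ` is unramified where `V` is
  (`FramedGaloisRep.eventually_isUnramifiedAt_induce`) and de Rham above `ℓ` because `V` is
  (named fact `IsDeRhamFramedInduceSchema`, Patrikis Lemma 7.2.1) and blocks of a de Rham block
  sum are de Rham (`PstWeilDeligneData.isDeRhamFramed_blocks`, `isDeRhamFramed_conj_iff`).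
  This is the NON-VACUITY of the crux's hypothesis family, isolated so that it can be closed now.
* `stub_weakDescentOfConstituent` — THE OPEN CORE, named: given ONE such pair (`σ` irreducible
  geometric over `K` with `ρ` a block summand of `σ|Γ_L`, and an L-algebraic cuspidal `P` on
  `GL_m(𝔸_K)` with `Corresponds RK ι P σ`), there is an L-algebraic cuspidal `π` on `GL_n(𝔸_L)`
  matching `ρ` at almost every place (Satake–Frobenius).  This is base change of `P` along the
  possibly NON-SOLVABLE extension `L/K` followed by extraction of the cuspidal constituent
  labelled by `ρ` (size XL; `SolvableImageBarrier` bites exactly here and nowhere else).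
* `stub_relativeLocalGlobal` — RELATIVE WEAK-TO-STRONG (size L–XL): in the same situation, an
  L-algebraic cuspidal `π` over `L` matching `ρ` at almost every place satisfies local–global
  compatibility with `ρ` at EVERY finite place of `L` (data `RL`), the input being full
  local–global compatibility of `P ↔ σ` over `K` (data `RK`): at `w ∣ v` the Weil–Deligne
  representation of `ρ|Γ_{L_w}` is a summand of `WD(σ|Γ_{K_v})|_{W_{L_w}}`, whose class is
  `rec_v(P_v)|_{W_{L_w}}` (local base change through `rec`, Arthur–Clozel Ch. 1 §6 /
  Harris–Taylor + Henniart), and `π_w` must be identified with the `ρ`-labelled constituent; at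
  `w ∣ ℓ` the pinned `D_pst` data of `L_w` and `K_v` must be compared (`DeRhamBaseChange_holds`
  gives only the de Rham clause).

Composition `RelativeDescent_of` is a real proof (pure logic + the tree's
`isCompact_glFiniteIntegralLevel_holds` to name a level over `K`); sorries: exactly three, one per
`stub_*`.  Relation to the earlier registration (type-sketch 573875563d: `stub_weakRelativeDescent`
+ `stub_relativeLGC`): the same weak/strong seam, with the Galois-side extraction of the induced
constituent now split OFF the open core (stub 1) and both automorphic stubs posed RELATIVE to the
single automorphic input `P ↔ σ` they actually consume.
-/

set_option linter.dupNamespace false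
set_option linter.unusedVariables false

open Filter

namespace Summit.Langlands.Langlands.Cruxes.RelativeDescent.Birth

/-! ## Registered stubs -/

/-- STUB 1 — AN INDUCED CONSTITUENT CARRYING `ρ` (Galois side; size M–L, provable modulo the named
p-adic Hodge schemata): for a finite extension of number fields `L/K` and an irreducible `ρ :
Γ_L → GL_n(ℚ̄_ℓ)`, `n ≥ 1`, geometric for the pinned Fontaine data, there is an irreducible
`σ : Γ_K → GL_m(ℚ̄_ℓ)`, `m ≥ 1`, geometric for the pinned data, such that `ρ` is a block summand of
`σ|Γ_L`: `conj g (σ|Γ_L) = reindex e (ρ ⊞ τ)`.  (`σ` = an irreducible summand of the semisimple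
`Ind_{Γ_L}^{Γ_K} ρ` receiving `ρ` under Frobenius reciprocity; `σ|Γ_L` is semisimple in
characteristic `0`; unramified a.e. and de Rham above `ℓ` are inherited from `Ind ρ` by blocks.)
Why it might fail as typed: only through the pinned-datum formalism — the de Rham transfer
`ρ ↦ Ind ρ` between the Fontaine data of `L_w` and `K_v` is the unproved named schema
`IsDeRhamFramedInduceSchema`. [cite: Patrikis2019, Lemma 7.2.1] [cite: BrinonConrad2009, Thm. 5.2.1]
[cite: SerreLinearRepresentations1977, §7.2–7.4 (Frobenius reciprocity, Mackey)] -/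
theorem stub_inducedConstituent :
    ∀ (K L : Type) [Field K] [NumberField K] [Field L] [NumberField L] [Algebra K L]
      (n : ℕ), 0 < n →
      ∀ (RL : ReciprocityData L) (RK : ReciprocityData K) (ℓ : ℕ) [Fact ℓ.Prime]
        (ρ : Literature.NumberTheory.GaloisRepresentations.FramedGaloisRep L (PadicAlgCl ℓ) n),
        ρ.toGaloisRep.IsIrreducible → IsGeometricFramed RL ρ →
        ∃ m : ℕ, 0 < m ∧
          ∃ σ : Literature.NumberTheory.GaloisRepresentations.FramedGaloisRep K (PadicAlgCl ℓ) m,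
            σ.toGaloisRep.IsIrreducible ∧ IsGeometricFramed RK σ ∧
            ∃ (m' : ℕ)
              (τ : Literature.NumberTheory.GaloisRepresentations.FramedGaloisRep L (PadicAlgCl ℓ) m')
              (e : Fin (n + m') ≃ Fin m) (g : Matrix.GeneralLinearGroup (Fin m) (PadicAlgCl ℓ)),
              Literature.NumberTheory.GaloisRepresentations.FramedRep.conj g (σ.restrictField L) =
                Literature.NumberTheory.GaloisRepresentations.FramedRep.reindex e
                  (Literature.NumberTheory.GaloisRepresentations.FramedGaloisRep.blockSum ρ τ) := by
  sorry

/-- STUB 2 — WEAK DESCENT OF ONE AUTOMORPHIC CONSTITUENT (the open core, named; size XL): `K`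
imaginary quadratic, `L ⊃ K` finite, `ρ : Γ_L → GL_n(ℚ̄_ℓ)` irreducible geometric; `σ : Γ_K →
GL_m(ℚ̄_ℓ)` irreducible geometric with `ρ` a block summand of `σ|Γ_L`, and `P` an L-algebraic
cuspidal representation of `GL_m(𝔸_K)` corresponding to `σ` (full local–global compatibility, data
`RK`).  THEN some L-algebraic cuspidal `π` of `GL_n(𝔸_L)` matches `ρ` at almost every finite place
of `L` (Satake–Frobenius).  Mechanism in print only for SOLVABLE `L/K` (Arthur–Clozel: cyclic prime
layers, base change of `P`, Clifford extraction of the `ρ`-labelled cuspidal constituent of the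
isobaric `BC_{L/K}(P)`); for insoluble `L/K` it is non-solvable base change for `GL_m` plus the
constituent-labelling problem.  Why it might fail: implied by the summit (reciprocity over `L`), so
it dies only with `Langlands`; no unconditional tool across an insoluble layer (Getz's trace
identities are conditional; Brauer + solvable base change give virtual automorphy only).
[cite: ArthurClozelAMS120, Ch. 3 Thms 4.2, 5.1, 6.2] [cite: Getz2012Nonsolvable]
[cite: BarnetlambEtAl2014, §5] -/
theorem stub_weakDescentOfConstituent :
    ∀ (K L : Type) [Field K] [NumberField K] [Field L] [NumberField L] [Algebra K L],
      NumberField.IsTotallyComplex K → Module.finrank ℚ K = 2 →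
      ∀ (n : ℕ), 0 < n →
      ∀ (hL : Literature.NumberTheory.Automorphic.isCompact_glFiniteIntegralLevel n L)
        (RL : ReciprocityData L) (RK : ReciprocityData K) (ℓ : ℕ) [Fact ℓ.Prime]
        (ι : PadicAlgCl ℓ ≃+* ℂ)
        (ρ : Literature.NumberTheory.GaloisRepresentations.FramedGaloisRep L (PadicAlgCl ℓ) n),
        ρ.toGaloisRep.IsIrreducible → IsGeometricFramed RL ρ →
        ∀ (m : ℕ), 0 < m →
        ∀ (hK : Literature.NumberTheory.Automorphic.isCompact_glFiniteIntegralLevel m K)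
          (σ : Literature.NumberTheory.GaloisRepresentations.FramedGaloisRep K (PadicAlgCl ℓ) m),
          σ.toGaloisRep.IsIrreducible → IsGeometricFramed RK σ →
          (∃ (m' : ℕ)
              (τ : Literature.NumberTheory.GaloisRepresentations.FramedGaloisRep L (PadicAlgCl ℓ) m')
              (e : Fin (n + m') ≃ Fin m) (g : Matrix.GeneralLinearGroup (Fin m) (PadicAlgCl ℓ)),
              Literature.NumberTheory.GaloisRepresentations.FramedRep.conj g (σ.restrictField L) =
                Literature.NumberTheory.GaloisRepresentations.FramedRep.reindex e
                  (Literature.NumberTheory.GaloisRepresentations.FramedGaloisRep.blockSum ρ τ)) →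
          ∀ (P : Literature.NumberTheory.Automorphic.CuspidalAutomorphicRepData m K hK),
            P.1.IsLAlgebraic → Corresponds RK ι P.1 σ →
            ∃ π : Literature.NumberTheory.Automorphic.CuspidalAutomorphicRepData n L hL,
              π.1.IsLAlgebraic ∧
                ∀ᶠ w : IsDedekindDomain.HeightOneSpectrum (NumberField.RingOfIntegers L) in cofinite,
                  SatakeFrobCompatibleAt ι π.1 ρ w := by
  sorry

/-- STUB 3 — RELATIVE WEAK-TO-STRONG LOCAL–GLOBAL COMPATIBILITY (size L–XL): in the situation of
stub 2 (`σ ↔ P` over `K` with FULL local–global compatibility for the data `RK`, `ρ` a block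
summand of `σ|Γ_L`), every L-algebraic cuspidal `π` of `GL_n(𝔸_L)` matching `ρ` at almost every
place satisfies `Corresponds RL ι π ρ`, i.e. local–global compatibility at EVERY finite place `w`
of `L`: away from `ℓ`, `WD(ρ|Γ_{L_w})` is a summand of `WD(σ|Γ_{K_v})|_{W_{L_w}}`, of class
`rec_v(P_v)|_{W_{L_w}}` by the hypothesis over `K` and compatibility of `rec` with restriction of
parameters (local base change), and `π_w` has to be identified with the `ρ`-labelled constituent;
above `ℓ`, the pinned `D_pst` data of `L_w` and `K_v` must be compared.  Why it might fail: the
identification of `π_w` at places where `π` is ramified is in print only as an OUTPUT of a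
trace-formula comparison (solvable layers) or for regular `π` over CM fields (Caraiani, Varma), and
`L` is in general not CM; implied by the summit (strong multiplicity one makes `π` the reciprocal
partner of `ρ`). [cite: ArthurClozelAMS120, Ch. 1 §6] [cite: HarrisTaylorAMS2001, Thm. A]
[cite: HenniartInventiones2000] [cite: Caraiani2012, Thm. 1.1] -/
theorem stub_relativeLocalGlobal :
    ∀ (K L : Type) [Field K] [NumberField K] [Field L] [NumberField L] [Algebra K L],
      NumberField.IsTotallyComplex K → Module.finrank ℚ K = 2 →
      ∀ (n : ℕ), 0 < n →
      ∀ (hL : Literature.NumberTheory.Automorphic.isCompact_glFiniteIntegralLevel n L)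
        (RL : ReciprocityData L) (RK : ReciprocityData K) (ℓ : ℕ) [Fact ℓ.Prime]
        (ι : PadicAlgCl ℓ ≃+* ℂ)
        (ρ : Literature.NumberTheory.GaloisRepresentations.FramedGaloisRep L (PadicAlgCl ℓ) n),
        ρ.toGaloisRep.IsIrreducible → IsGeometricFramed RL ρ →
        ∀ (m : ℕ), 0 < m →
        ∀ (hK : Literature.NumberTheory.Automorphic.isCompact_glFiniteIntegralLevel m K)
          (σ : Literature.NumberTheory.GaloisRepresentations.FramedGaloisRep K (PadicAlgCl ℓ) m),
          σ.toGaloisRep.IsIrreducible → IsGeometricFramed RK σ →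
          (∃ (m' : ℕ)
              (τ : Literature.NumberTheory.GaloisRepresentations.FramedGaloisRep L (PadicAlgCl ℓ) m')
              (e : Fin (n + m') ≃ Fin m) (g : Matrix.GeneralLinearGroup (Fin m) (PadicAlgCl ℓ)),
              Literature.NumberTheory.GaloisRepresentations.FramedRep.conj g (σ.restrictField L) =
                Literature.NumberTheory.GaloisRepresentations.FramedRep.reindex e
                  (Literature.NumberTheory.GaloisRepresentations.FramedGaloisRep.blockSum ρ τ)) →
          ∀ (P : Literature.NumberTheory.Automorphic.CuspidalAutomorphicRepData m K hK),
            P.1.IsLAlgebraic → Corresponds RK ι P.1 σ →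
            ∀ (π : Literature.NumberTheory.Automorphic.CuspidalAutomorphicRepData n L hL),
              π.1.IsLAlgebraic →
              (∀ᶠ w : IsDedekindDomain.HeightOneSpectrum (NumberField.RingOfIntegers L) in cofinite,
                  SatakeFrobCompatibleAt ι π.1 ρ w) →
              Corresponds RL ι π.1 ρ := by
  sorry

/-! ## The composition (sorry-free) -/

/-- COMPOSITION: the three stub statements imply the crux `ImaginaryQuadraticAnchor.RelativeDescent`
(route decl, by name).  Stub 1 produces an irreducible geometric `σ` over `K` carrying `ρ` in its
restriction; the crux's hypothesis family, instantiated at `σ` (level `GL_m(𝒪̂_K)`, compact by the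
tree's `isCompact_glFiniteIntegralLevel_holds`), gives the L-algebraic cuspidal `P ↔ σ`; stub 2
descends it weakly to `π` over `L`; stub 3 upgrades `π ↔ ρ` to every finite place. [folklore] -/
theorem RelativeDescent_of
    (hConst : ∀ (K L : Type) [Field K] [NumberField K] [Field L] [NumberField L] [Algebra K L]
      (n : ℕ), 0 < n →
      ∀ (RL : ReciprocityData L) (RK : ReciprocityData K) (ℓ : ℕ) [Fact ℓ.Prime]
        (ρ : Literature.NumberTheory.GaloisRepresentations.FramedGaloisRep L (PadicAlgCl ℓ) n),
        ρ.toGaloisRep.IsIrreducible → IsGeometricFramed RL ρ →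
        ∃ m : ℕ, 0 < m ∧
          ∃ σ : Literature.NumberTheory.GaloisRepresentations.FramedGaloisRep K (PadicAlgCl ℓ) m,
            σ.toGaloisRep.IsIrreducible ∧ IsGeometricFramed RK σ ∧
            ∃ (m' : ℕ)
              (τ : Literature.NumberTheory.GaloisRepresentations.FramedGaloisRep L (PadicAlgCl ℓ) m')
              (e : Fin (n + m') ≃ Fin m) (g : Matrix.GeneralLinearGroup (Fin m) (PadicAlgCl ℓ)),
              Literature.NumberTheory.GaloisRepresentations.FramedRep.conj g (σ.restrictField L) =
                Literature.NumberTheory.GaloisRepresentations.FramedRep.reindex e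
                  (Literature.NumberTheory.GaloisRepresentations.FramedGaloisRep.blockSum ρ τ))
    (hWeak : ∀ (K L : Type) [Field K] [NumberField K] [Field L] [NumberField L] [Algebra K L],
      NumberField.IsTotallyComplex K → Module.finrank ℚ K = 2 →
      ∀ (n : ℕ), 0 < n →
      ∀ (hL : Literature.NumberTheory.Automorphic.isCompact_glFiniteIntegralLevel n L)
        (RL : ReciprocityData L) (RK : ReciprocityData K) (ℓ : ℕ) [Fact ℓ.Prime]
        (ι : PadicAlgCl ℓ ≃+* ℂ)
        (ρ : Literature.NumberTheory.GaloisRepresentations.FramedGaloisRep L (PadicAlgCl ℓ) n),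
        ρ.toGaloisRep.IsIrreducible → IsGeometricFramed RL ρ →
        ∀ (m : ℕ), 0 < m →
        ∀ (hK : Literature.NumberTheory.Automorphic.isCompact_glFiniteIntegralLevel m K)
          (σ : Literature.NumberTheory.GaloisRepresentations.FramedGaloisRep K (PadicAlgCl ℓ) m),
          σ.toGaloisRep.IsIrreducible → IsGeometricFramed RK σ →
          (∃ (m' : ℕ)
              (τ : Literature.NumberTheory.GaloisRepresentations.FramedGaloisRep L (PadicAlgCl ℓ) m')
              (e : Fin (n + m') ≃ Fin m) (g : Matrix.GeneralLinearGroup (Fin m) (PadicAlgCl ℓ)),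
              Literature.NumberTheory.GaloisRepresentations.FramedRep.conj g (σ.restrictField L) =
                Literature.NumberTheory.GaloisRepresentations.FramedRep.reindex e
                  (Literature.NumberTheory.GaloisRepresentations.FramedGaloisRep.blockSum ρ τ)) →
          ∀ (P : Literature.NumberTheory.Automorphic.CuspidalAutomorphicRepData m K hK),
            P.1.IsLAlgebraic → Corresponds RK ι P.1 σ →
            ∃ π : Literature.NumberTheory.Automorphic.CuspidalAutomorphicRepData n L hL,
              π.1.IsLAlgebraic ∧
                ∀ᶠ w : IsDedekindDomain.HeightOneSpectrum (NumberField.RingOfIntegers L) in cofinite,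
                  SatakeFrobCompatibleAt ι π.1 ρ w)
    (hLGC : ∀ (K L : Type) [Field K] [NumberField K] [Field L] [NumberField L] [Algebra K L],
      NumberField.IsTotallyComplex K → Module.finrank ℚ K = 2 →
      ∀ (n : ℕ), 0 < n →
      ∀ (hL : Literature.NumberTheory.Automorphic.isCompact_glFiniteIntegralLevel n L)
        (RL : ReciprocityData L) (RK : ReciprocityData K) (ℓ : ℕ) [Fact ℓ.Prime]
        (ι : PadicAlgCl ℓ ≃+* ℂ)
        (ρ : Literature.NumberTheory.GaloisRepresentations.FramedGaloisRep L (PadicAlgCl ℓ) n),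
        ρ.toGaloisRep.IsIrreducible → IsGeometricFramed RL ρ →
        ∀ (m : ℕ), 0 < m →
        ∀ (hK : Literature.NumberTheory.Automorphic.isCompact_glFiniteIntegralLevel m K)
          (σ : Literature.NumberTheory.GaloisRepresentations.FramedGaloisRep K (PadicAlgCl ℓ) m),
          σ.toGaloisRep.IsIrreducible → IsGeometricFramed RK σ →
          (∃ (m' : ℕ)
              (τ : Literature.NumberTheory.GaloisRepresentations.FramedGaloisRep L (PadicAlgCl ℓ) m')
              (e : Fin (n + m') ≃ Fin m) (g : Matrix.GeneralLinearGroup (Fin m) (PadicAlgCl ℓ)),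
              Literature.NumberTheory.GaloisRepresentations.FramedRep.conj g (σ.restrictField L) =
                Literature.NumberTheory.GaloisRepresentations.FramedRep.reindex e
                  (Literature.NumberTheory.GaloisRepresentations.FramedGaloisRep.blockSum ρ τ)) →
          ∀ (P : Literature.NumberTheory.Automorphic.CuspidalAutomorphicRepData m K hK),
            P.1.IsLAlgebraic → Corresponds RK ι P.1 σ →
            ∀ (π : Literature.NumberTheory.Automorphic.CuspidalAutomorphicRepData n L hL),
              π.1.IsLAlgebraic →
              (∀ᶠ w : IsDedekindDomain.HeightOneSpectrum (NumberField.RingOfIntegers L) in cofinite,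
                  SatakeFrobCompatibleAt ι π.1 ρ w) →
              Corresponds RL ι π.1 ρ) :
    Summit.Langlands.Langlands.Theses.ImaginaryQuadraticAnchor.RelativeDescent := by
  intro K L _ _ _ _ _ hTC hdeg n hn hL RL RK ℓ _ ι ρ hirr hgeo hFamily
  -- (1) an irreducible geometric constituent `σ` of `Ind ρ` over `K` carrying `ρ` in `σ|Γ_L`
  obtain ⟨m, hm, σ, hσirr, hσgeo, hblock⟩ := hConst K L n hn RL RK ℓ ρ hirr hgeo
  -- (2) the crux hypothesis at `σ`: an L-algebraic cuspidal `P` on `GL_m(𝔸_K)` with `P ↔ σ`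
  obtain ⟨P, hPalg, hPcorr⟩ :=
    hFamily m hm (Literature.NumberTheory.Automorphic.isCompact_glFiniteIntegralLevel_holds m K)
      σ hσirr hσgeo hblock
  -- (3) weak descent of `P` along `L/K` to the `ρ`-labelled cuspidal `π`
  obtain ⟨π, hπalg, hπweak⟩ :=
    hWeak K L hTC hdeg n hn hL RL RK ℓ ι ρ hirr hgeo m hm
      (Literature.NumberTheory.Automorphic.isCompact_glFiniteIntegralLevel_holds m K)
      σ hσirr hσgeo hblock P hPalg hPcorr
  -- (4) upgrade a.e. Satake–Frobenius matching to local–global compatibility at every place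
  exact ⟨π, hπalg,
    hLGC K L hTC hdeg n hn hL RL RK ℓ ι ρ hirr hgeo m hm
      (Literature.NumberTheory.Automorphic.isCompact_glFiniteIntegralLevel_holds m K)
      σ hσirr hσgeo hblock P hPalg hPcorr π hπalg hπweak⟩

/-- The same composition with the three registered stubs consumed BY NAME (kernel check that the
hypotheses of `RelativeDescent_of` are the stub signatures verbatim; inherits their `sorry`s,
contains none). [folklore] -/
theorem RelativeDescent_of_stubs :
    Summit.Langlands.Langlands.Theses.ImaginaryQuadraticAnchor.RelativeDescent :=
  RelativeDescent_of stub_inducedConstituent stub_weakDescentOfConstituent stub_relativeLocalGlobal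

end Summit.Langlands.Langlands.Cruxes.RelativeDescent.Birth
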